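import Summits.QuantumFields.YangMills.Theorems.BalabanUVNodesN15KingModelFullPropagatorMixedProfile
import Summits.QuantumFields.YangMills.Theorems.BalabanUVNodesN15KingModelFullPropagatorGradHolderSlice
import Summits.QuantumFields.YangMills.Theorems.BalabanUVNodesN15KingModelFullPropagatorOperatorEntries

/-!
# BalabanUVNodes ∕ N15 — THE KING-MODEL RUNG, CURVED EDITION (PART W-a): HÖLDER IN THE OBSERVATION POINT, DERIVATIVE ON THE SOURCE — the SLICE level:
# the source-differentiated single-scale piece `Σ_w(Σ_z ℋ(x,z)C(z,w))∂ℋ(y,w)`, its Hölder difference in `x` (King's (3.65) with `a = 0`, `|b| = 1`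
# for the assembled piece, mass-uniform), and the source-differentiated peel — inputs of the sequel `…GradSourceHolderProfile`
# (the kernel of [B9]'s (3.43) second Hölder entry `‖ζG∇*_Uλ‖_β` at `U ≡ 1`)
# (Track A, DAG node N15 = NE2; FAN-OUT v1.1 §N15 s3 «KING-MODEL RUNG … + the one-line statement of what the curved case adds»)

HONEST FRAMING.  Count-neutral kernel bookkeeping (cell `pub-ymgap`, seat `pub-ymgap-dag-n15-e` g9; `--supports stmt-QuantumFields-20544
--as helper` = K3⁷ `SpineGivenEndpointR13SepCoPH`, WORDS-143).  TEMPLATE LITERATURE, `A = 0`: C. King's scalar U(1)-Higgs MODEL on finite tori ([King1986]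
§2.2 p. 653 (2.13)–(2.17), p. 654 (2.20), Theorem 3.3 pp. 655–656, (3.62) p. 663, Prop. 3.7 (3.65) p. 663 «`|(∂_α(x, y)D^a_xD^b_zG_{(j)})(z)| ≤
C(L^jη)^{2−d−|a|−|b|−α}exp[−δ₀(L^jη)^{−1}dist({x, y}, z)]`»; King's `d` = this file's `d + 1`), NOT Bałaban's covariant objects; [Balaban1985BackgroundPropagators]
Thm 3.1 (3.43) p. 398 (the Hölder norms `‖ζ∇_UGλ‖_β, ‖ζG∇*_Uλ‖_β`; the sequel `…AdjGradHolderOperator` is the second one at `U ≡ 1`).  The profile below is the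
(2.17)-SUMMED SHAPE of the `a = 0, |b| = 1` clause of (3.65) for King's (2.13) at `A = 0`, NOT a printed proposition; NE2⁺ is NOT PRINTED and not proved
here; NOT a node discharge; nothing continuum ∕ ℝ⁴ ∕ OS ∕ mass-gap ∕ Clay.  0 `sorry`, 0 `def`, standard axioms.

THE POINT.  Part U-b did the Hölder difference in `x` of the `x`-gradient `∂^{(1)}_μG(x, y)` ((3.65), `|a| = 1, b = 0`; bottom level = [Ba 4] (1.9)).  THIS FILE
does the Hölder difference in `x` of the SOURCE gradient `∂^{(2)}_νG(x, y) := N·[G(x, y + e_ν) − G(x, y)]` — the kernel behind the transposed-gradient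
operator `A₀⁻¹∇*_ν` (part Q4a `inv_mulVec_adjDeriv_eq_sum`), for which [Ba 4] prints NO Hölder clause ((1.9) is for `D_μG_kf` only).  The peel runs as in
U-b: per level `ΛL` (one η-difference) times `L^α` (the weight, U-a `div_mul_rpow_neg`); the slice term is `Σ_w(Σ_z[ℋ(x′, z) − ℋ(x, z)]C(z, w))∂ℋ(y, w)`
(§1 `ksSliceD2_eq`; rows = King's (3.65) for the VALUE `ℋ_K` with the mass inside, `holder_kernel_decay_blocks_unif`, split into two single-source rows;
leg = part M′ `ksDH_decay_unif`); the bottom level `K = 1` needs no Hölder input at all (`N = L` is a constant: `constrainedProp_symm` + [Ba 4] (1.10)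
clause 2 for `∂^{(1)}G(y, ·)`, weight `(ρ∕L)^{−α} ≤ L^α ≤ L`).
* `ksSliceD2_eq`, ★ `ksSliceD2_holder_unif`, `fullPropD2_peel` — consumed by the sequel's peel induction
  (`fullPropD2_holder_profile_unif`: `(ρ∕N)^{−α}·|∂^{(2)}_νG(x′, y) − ∂^{(2)}_νG(x, y)| ≤ C·Σ_{i<K}(ΛL)^i(L^i)^α·e^{−δ·m·L^i∕N}`, all points).
WHAT THE CURVED CASE ADDS (one line): the same for `G_k(U)∇*_U` uniformly over the live window `Reg335` ([B9] (3.43), printed, no η-rate).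
HONEST SCOPE.  (i) `A = 0`, periodic b.c., odd `L ≥ 3`, `0 < m² ≤ m₀²`, cubes `2L^e`, `0 < α < 1`; (ii) lattice units of level `K`; sup torus distance;
(iii) `K ≥ 1`; (iv) Hölder in the observation point, ONE forward difference on the source; (v) not Bałaban's `G_k(U)`; not a discharge.
Locators: [King1986] C. King, CMP **102** (1986) 649–677: (2.13)–(2.17) p. 653, (2.20) p. 654, Theorem 3.3 p. 655, (3.62), Prop. 3.7 (3.65) p. 663,
(4.42)–(4.44) p. 675; [Ba 4] = [Balaban1983RegularityDecay] Theorem (1.9)–(1.10) p. 573; [Balaban1985BackgroundPropagators] Thm 3.1 (3.43) p. 398.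
-/

noncomputable section

namespace Summit.QuantumFields.YangMills.BalabanUVNodes.N15KingModelRung.Curved

open Real Finset Matrix
open Literature.MathematicalPhysics.QuantumFieldTheory.Balaban1983to89 (Params)
open Literature.MathematicalPhysics.QuantumFieldTheory.Balaban1983to89.B4Sect5Proof (latticeConst)
open Literature.MathematicalPhysics.QuantumFieldTheory.Balaban1983to89.B5Prop11Plancherel (Tor fine unitVec)
open Literature.MathematicalPhysics.QuantumFieldTheory.King1986 (aK aK_pos aK_le)
open Literature.MathematicalPhysics.QuantumFieldTheory.King1986.Torus (constrainedProp flatten blockOf tdistT minimiser holdist flatten_add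
  flatten_unitVec tdistT_nonneg tdistT_symm tdistT_triangle tdistT_sumBound gam0L kapCT kapCT_pos_le holder_kernel_decay_blocks_unif
  constrainedProp_deriv_decay_blocks_unif)
open Summit.QuantumFields.YangMills.BalabanUVNodes.N15.KingModel (kingRho kingRhoB)

variable {d : ℕ} (L : ℕ) [NeZero L]

/-! ## §1 The source-differentiated slice: identity, Hölder difference in the observation point, peel -/

/-- **THE SOURCE-DIFFERENTIATED SLICE**: `L^j·[ksSlice(x, y + e_ν) − ksSlice(x, y)] = Σ_w(Σ_z ℋ_j(x, z)·C^{(j)}(z, w))·∂^η_νℋ_j(y, w)` — (4.42) with the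
`y`-leg differentiated (V-a `triple_sub_right`∕`triple_smul_right`). [cite: King1986, (4.42) p.675, Prop. 3.7 (3.63) p.663 (object `D^b_yG_{(j)}`)] -/
theorem ksSliceD2_eq (a m2 : ℝ) (i : KSliceIdx d) (ν : Fin (d + 1)) (x y : Tor (fine (L ^ i.j) (ksU L i))) :
    ((L ^ i.j : ℕ) : ℝ) * (ksSlice L a m2 i x (y + unitVec (fine (L ^ i.j) (ksU L i)) ν) - ksSlice L a m2 i x y)
      = triple (ksH L a m2 i x) (ksC L a m2 i) (ksDH L a m2 i ν y) := by
  rw [ksSlice, ksSlice, ← triple_sub_right, ← triple_smul_right]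
  rfl

/-- **THE HÖLDER DIFFERENCE IN THE OBSERVATION POINT OF THE SOURCE-DIFFERENTIATED SLICE, ONE `(C, δ)` FOR ALL MASSES `0 < m² ≤ m₀²`**: for `0 < α < 1`,
`∃ C δ > 0` such that for every mass under the cap, every slice index (`N = L^j`), every direction and ALL `x, x′, y`:
`(|x − x′|∕N)^{−α}·|Σ_w(Σ_z[ℋ(x′, z) − ℋ(x, z)]C(z, w))∂ℋ(y, w)| ≤ C·(e^{−δ|B(x) − B(y)|_U} + e^{−δ|B(x′) − B(y)|_U})` — the rows carry King's (3.65) for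
the VALUE `ℋ_j` with the mass inside (`holder_kernel_decay_blocks_unif`, decay in `min(|B(x) − z|, |B(x′) − z|)` ≤ the sum of two single-source
rows, U-a `abs_triple_le_of_two_rows`), the middle leg n15-d's `kingCov_abs_le`, the last leg part M′ `ksDH_decay_unif`; part M v1.1 `triple_decay` twice.
[cite: King1986, (3.62) p.663, Prop. 3.7 (3.65) p.663, (4.34) p.674, (4.41)–(4.42) p.675] -/
theorem ksSliceD2_holder_unif (hLodd : Odd L) (hL : 2 ≤ L) {a : ℝ} (ha : 0 < a) {m0sq : ℝ} (hm0 : 0 ≤ m0sq)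
    {α : ℝ} (hα0 : 0 < α) (hα1 : α < 1) :
    ∃ C δ : ℝ, 0 < C ∧ 0 < δ ∧ ∀ (m2 : ℝ), 0 < m2 → m2 ≤ m0sq → ∀ (i : KSliceIdx d) (ν : Fin (d + 1))
      (x x' y : Tor (fine (L ^ i.j) (ksU L i))),
      (tdistT (fine (L ^ i.j) (ksU L i)) x x' / ((L ^ i.j : ℕ) : ℝ)) ^ (-α)
          * |triple (ksH L a m2 i x') (ksC L a m2 i) (ksDH L a m2 i ν y) - triple (ksH L a m2 i x) (ksC L a m2 i) (ksDH L a m2 i ν y)|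
        ≤ C * (Real.exp (-(δ * tdistT (ksU L i) (blockOf (L ^ i.j) (ksU L i) x) (blockOf (L ^ i.j) (ksU L i) y)))
              + Real.exp (-(δ * tdistT (ksU L i) (blockOf (L ^ i.j) (ksU L i) x') (blockOf (L ^ i.j) (ksU L i) y)))) := by
  have hL1 : 1 < L := by omega
  obtain ⟨δ₂, cD, hδ₂, hcD, Ddec⟩ := ksDH_decay_unif (d := d) L hLodd hL ha hm0
  obtain ⟨δ₃, c₃, hδ₃, hc₃, Hhol⟩ := holder_kernel_decay_blocks_unif (d + 1) L (Nat.succ_pos d) hLodd hL ha hm0 hα0 hα1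
  have hcC := ksC_const_pos (d := d) L hL ha
  obtain ⟨hκ', _⟩ := kapCT_pos_le (d := d + 1) ha hL
  obtain ⟨κ, hκ, hκ₂, hκ₃, hκC⟩ : ∃ κ : ℝ, 0 < κ ∧ κ ≤ δ₂ ∧ κ ≤ δ₃ ∧ κ ≤ kapCT (d + 1) a L :=
    ⟨min (min δ₂ δ₃) (kapCT (d + 1) a L), lt_min (lt_min hδ₂ hδ₃) hκ', (min_le_left _ _).trans (min_le_left _ _),
      (min_le_left _ _).trans (min_le_right _ _), min_le_right _ _⟩
  set cC : ℝ := (gam0L (d + 1) a L - (kingRho (d + 1) a L + kingRhoB (d + 1) a L))⁻¹ with hcC_def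
  refine ⟨c₃ * cC * cD * latticeConst (d + 1) (κ / 2) ^ 2 + 1, κ / 2, by positivity, half_pos hκ, fun m2 hm hcap i ν x x' y => ?_⟩
  have ht0 := tdistT_nonneg (ksU L i)
  have exp_rate_mono : ∀ {κ' r t : ℝ}, κ' ≤ r → 0 ≤ t → Real.exp (-(r * t)) ≤ Real.exp (-(κ' * t)) :=
    fun hκr ht => Real.exp_le_exp.mpr (neg_le_neg (mul_le_mul_of_nonneg_right hκr ht))
  have hVs : ∀ u : Tor (ksU L i), ∑ z, Real.exp (-(κ / 2 * tdistT (ksU L i) u z)) ≤ latticeConst (d + 1) (κ / 2) := fun u =>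
    tdistT_sumBound (ksU L i) (κ / 2) (half_pos hκ) u
  have hV2 : c₃ * cC * cD * latticeConst (d + 1) (κ / 2) ^ 2 ≤ c₃ * cC * cD * latticeConst (d + 1) (κ / 2) ^ 2 + 1 := by linarith
  set w : ℝ := (tdistT (fine (L ^ i.j) (ksU L i)) x x' / ((L ^ i.j : ℕ) : ℝ)) ^ (-α) with hwdef
  have hw0 : 0 ≤ w := Real.rpow_nonneg (div_nonneg (tdistT_nonneg _ _ _) (Nat.cast_nonneg _)) _
  -- the weighted difference is a triple contraction with the weighted two-point row in the first leg
  have hid : w * (triple (ksH L a m2 i x') (ksC L a m2 i) (ksDH L a m2 i ν y) - triple (ksH L a m2 i x) (ksC L a m2 i) (ksDH L a m2 i ν y))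
      = triple (fun z => w * (ksH L a m2 i x' z - ksH L a m2 i x z)) (ksC L a m2 i) (ksDH L a m2 i ν y) := by
    rw [triple_smul_left, triple_sub_left]
  -- the two-point row: King's (3.65) for the VALUE `ℋ_j`, mass inside, read as the sum of two single-source rows
  have hrow : ∀ z, |w * (ksH L a m2 i x' z - ksH L a m2 i x z)|
      ≤ c₃ * Real.exp (-(κ * tdistT (ksU L i) (blockOf (L ^ i.j) (ksU L i) x) z))
        + c₃ * Real.exp (-(κ * tdistT (ksU L i) (blockOf (L ^ i.j) (ksU L i) x') z)) := by
    intro z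
    have h := Hhol (i.params L hLodd hL) rfl rfl i.one_le_j m2 hm hcap (ksU L i) (ksU_eq_sitesPerDir L hLodd hL i)
      (L ^ i.j) rfl x x' z
    have e : w * (ksH L a m2 i x' z - ksH L a m2 i x z)
        = -((holdist (L ^ i.j) (ksU L i) x x') ^ (-α)
            * (minimiser (L ^ i.j) (ksU L i) (aK a L i.j) ((((L ^ i.j : ℕ) : ℝ)) ^ 2) m2 (Pi.single z 1) x
              - minimiser (L ^ i.j) (ksU L i) (aK a L i.j) ((((L ^ i.j : ℕ) : ℝ)) ^ 2) m2 (Pi.single z 1) x')) := by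
      simp only [hwdef, ksH, kingH, holdist]
      ring
    rw [e, abs_neg]
    refine h.trans ?_
    rcases min_choice (tdistT (ksU L i) (blockOf (L ^ i.j) (ksU L i) x) z)
        (tdistT (ksU L i) (blockOf (L ^ i.j) (ksU L i) x') z) with hmin | hmin
    · rw [hmin]
      have h1 : Real.exp (-(δ₃ * tdistT (ksU L i) (blockOf (L ^ i.j) (ksU L i) x) z))
          ≤ Real.exp (-(κ * tdistT (ksU L i) (blockOf (L ^ i.j) (ksU L i) x) z)) := exp_rate_mono hκ₃ (ht0 _ _)
      nlinarith [Real.exp_pos (-(κ * tdistT (ksU L i) (blockOf (L ^ i.j) (ksU L i) x') z)), hc₃.le]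
    · rw [hmin]
      have h1 : Real.exp (-(δ₃ * tdistT (ksU L i) (blockOf (L ^ i.j) (ksU L i) x') z))
          ≤ Real.exp (-(κ * tdistT (ksU L i) (blockOf (L ^ i.j) (ksU L i) x') z)) := exp_rate_mono hκ₃ (ht0 _ _)
      nlinarith [Real.exp_pos (-(κ * tdistT (ksU L i) (blockOf (L ^ i.j) (ksU L i) x) z)), hc₃.le]
  -- the middle and last legs at the common rate
  have hB : ∀ v, |(fun v => |ksDH L a m2 i ν y v|) v|
      ≤ cD * Real.exp (-(κ * tdistT (ksU L i) v (blockOf (L ^ i.j) (ksU L i) y))) := fun v => by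
    show |(|ksDH L a m2 i ν y v|)| ≤ _
    rw [abs_abs, tdistT_symm]
    exact ((Ddec m2 hm.le hcap i ν).1 y v).trans (mul_le_mul_of_nonneg_left (exp_rate_mono hκ₂ (ht0 _ _)) hcD.le)
  have hCm : ∀ z v, |(fun z v => |ksC L a m2 i z v|) z v| ≤ cC * Real.exp (-(κ * tdistT (ksU L i) z v)) := fun z v => by
    show |(|ksC L a m2 i z v|)| ≤ _
    rw [abs_abs]
    exact ((ksC_decay L hL ha hm i z v).1).trans (mul_le_mul_of_nonneg_left (exp_rate_mono hκC (ht0 _ _)) hcC.le)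
  have hrow₁ : ∀ z, |(fun z => c₃ * Real.exp (-(κ * tdistT (ksU L i) (blockOf (L ^ i.j) (ksU L i) x) z))) z|
      ≤ c₃ * Real.exp (-(κ * tdistT (ksU L i) (blockOf (L ^ i.j) (ksU L i) x) z)) :=
    fun z => by rw [abs_of_nonneg (by positivity)]
  have hrow₂ : ∀ z, |(fun z => c₃ * Real.exp (-(κ * tdistT (ksU L i) (blockOf (L ^ i.j) (ksU L i) x') z))) z|
      ≤ c₃ * Real.exp (-(κ * tdistT (ksU L i) (blockOf (L ^ i.j) (ksU L i) x') z)) :=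
    fun z => by rw [abs_of_nonneg (by positivity)]
  have key₁ := triple_decay (tdistT (ksU L i)) ht0 (tdistT_triangle (ksU L i))
    (f := fun z => c₃ * Real.exp (-(κ * tdistT (ksU L i) (blockOf (L ^ i.j) (ksU L i) x) z)))
    (C := fun z v => |ksC L a m2 i z v|) (g := fun v => |ksDH L a m2 i ν y v|)
    (u₀ := blockOf (L ^ i.j) (ksU L i) x) (v₀ := blockOf (L ^ i.j) (ksU L i) y)
    hκ.le hc₃.le hcC.le hcD.le hrow₁ hCm hB hVs
  have key₂ := triple_decay (tdistT (ksU L i)) ht0 (tdistT_triangle (ksU L i))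
    (f := fun z => c₃ * Real.exp (-(κ * tdistT (ksU L i) (blockOf (L ^ i.j) (ksU L i) x') z)))
    (C := fun z v => |ksC L a m2 i z v|) (g := fun v => |ksDH L a m2 i ν y v|)
    (u₀ := blockOf (L ^ i.j) (ksU L i) x') (v₀ := blockOf (L ^ i.j) (ksU L i) y)
    hκ.le hc₃.le hcC.le hcD.le hrow₂ hCm hB hVs
  have hT₁ : 0 ≤ triple (fun z => c₃ * Real.exp (-(κ * tdistT (ksU L i) (blockOf (L ^ i.j) (ksU L i) x) z)))
      (fun z v => |ksC L a m2 i z v|) (fun v => |ksDH L a m2 i ν y v|) := by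
    simp only [triple]
    exact Finset.sum_nonneg fun v _ => mul_nonneg (Finset.sum_nonneg fun z _ => mul_nonneg (by positivity) (abs_nonneg _))
      (abs_nonneg _)
  have hT₂ : 0 ≤ triple (fun z => c₃ * Real.exp (-(κ * tdistT (ksU L i) (blockOf (L ^ i.j) (ksU L i) x') z)))
      (fun z v => |ksC L a m2 i z v|) (fun v => |ksDH L a m2 i ν y v|) := by
    simp only [triple]
    exact Finset.sum_nonneg fun v _ => mul_nonneg (Finset.sum_nonneg fun z _ => mul_nonneg (by positivity) (abs_nonneg _))
      (abs_nonneg _)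
  rw [abs_of_nonneg hT₁] at key₁
  rw [abs_of_nonneg hT₂] at key₂
  have hsplit := abs_triple_le_of_two_rows (C := ksC L a m2 i) (g := ksDH L a m2 i ν y)
    (f₁ := fun z => c₃ * Real.exp (-(κ * tdistT (ksU L i) (blockOf (L ^ i.j) (ksU L i) x) z)))
    (f₂ := fun z => c₃ * Real.exp (-(κ * tdistT (ksU L i) (blockOf (L ^ i.j) (ksU L i) x') z))) hrow
  have hE₁ := (Real.exp_pos (-(κ / 2 * tdistT (ksU L i) (blockOf (L ^ i.j) (ksU L i) x) (blockOf (L ^ i.j) (ksU L i) y)))).le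
  have hE₂ := (Real.exp_pos (-(κ / 2 * tdistT (ksU L i) (blockOf (L ^ i.j) (ksU L i) x') (blockOf (L ^ i.j) (ksU L i) y)))).le
  calc w * |triple (ksH L a m2 i x') (ksC L a m2 i) (ksDH L a m2 i ν y) - triple (ksH L a m2 i x) (ksC L a m2 i) (ksDH L a m2 i ν y)|
      = |w * (triple (ksH L a m2 i x') (ksC L a m2 i) (ksDH L a m2 i ν y)
          - triple (ksH L a m2 i x) (ksC L a m2 i) (ksDH L a m2 i ν y))| := by rw [abs_mul, abs_of_nonneg hw0]
    _ = |triple (fun z => w * (ksH L a m2 i x' z - ksH L a m2 i x z)) (ksC L a m2 i) (ksDH L a m2 i ν y)| := by rw [hid]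
    _ ≤ _ := hsplit
    _ ≤ c₃ * cC * cD * latticeConst (d + 1) (κ / 2) ^ 2
            * Real.exp (-(κ / 2 * tdistT (ksU L i) (blockOf (L ^ i.j) (ksU L i) x) (blockOf (L ^ i.j) (ksU L i) y)))
        + c₃ * cC * cD * latticeConst (d + 1) (κ / 2) ^ 2
            * Real.exp (-(κ / 2 * tdistT (ksU L i) (blockOf (L ^ i.j) (ksU L i) x') (blockOf (L ^ i.j) (ksU L i) y))) :=
        add_le_add key₁ key₂
    _ ≤ (c₃ * cC * cD * latticeConst (d + 1) (κ / 2) ^ 2 + 1)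
            * Real.exp (-(κ / 2 * tdistT (ksU L i) (blockOf (L ^ i.j) (ksU L i) x) (blockOf (L ^ i.j) (ksU L i) y)))
        + (c₃ * cC * cD * latticeConst (d + 1) (κ / 2) ^ 2 + 1)
            * Real.exp (-(κ / 2 * tdistT (ksU L i) (blockOf (L ^ i.j) (ksU L i) x') (blockOf (L ^ i.j) (ksU L i) y))) :=
        add_le_add (mul_le_mul_of_nonneg_right hV2 hE₁) (mul_le_mul_of_nonneg_right hV2 hE₂)
    _ = _ := by ring

/-- **THE SOURCE-DIFFERENTIATED PEEL**: `L^{K+1}·[G(K+1, M_e, m²)(flatten x, flatten y + e_ν) − G(K+1, M_e, m²)(flatten x, flatten y)]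
= (L^{d+1}∕L²)·L·[L^K·(G(K, fine L M_e, m²∕L²)(x, y + e_ν) − G(K, …)(x, y)) + Σ_w(Σ_z ℋ(x, z)C(z, w))∂ℋ(y, w)]` — part O-a's peel at `(x, y + e_ν)` and at
`(x, y)` (`flatten_unitVec`) and `ksSliceD2_eq`. [cite: King1986, (2.17) p.653, (2.20) p.654, (4.42) p.675] -/
theorem fullPropD2_peel (hL : 2 ≤ L) {a msq : ℝ} (ha : 0 < a) (hm : 0 < msq) (i : KSliceIdx d) (ν : Fin (d + 1))
    (x y : Tor (fine (L ^ i.j) (ksU L i))) :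
    ((L ^ i.j * L : ℕ) : ℝ) *
        (constrainedProp (L ^ i.j * L) (ksM L i) (aK a L (i.j + 1)) (((L ^ i.j * L : ℕ) : ℝ) ^ 2) msq
            (flatten (L ^ i.j) L (ksM L i) x) (flatten (L ^ i.j) L (ksM L i) y + unitVec (fine (L ^ i.j * L) (ksM L i)) ν)
          - constrainedProp (L ^ i.j * L) (ksM L i) (aK a L (i.j + 1)) (((L ^ i.j * L : ℕ) : ℝ) ^ 2) msq
            (flatten (L ^ i.j) L (ksM L i) x) (flatten (L ^ i.j) L (ksM L i) y))
      = (L : ℝ) ^ (d + 1) / (L : ℝ) ^ 2 * L *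
          (((L ^ i.j : ℕ) : ℝ) *
              (constrainedProp (L ^ i.j) (ksU L i) (aK a L i.j) (((L ^ i.j : ℕ) : ℝ) ^ 2) (msq / (L : ℝ) ^ 2)
                  x (y + unitVec (fine (L ^ i.j) (ksU L i)) ν)
                - constrainedProp (L ^ i.j) (ksU L i) (aK a L i.j) (((L ^ i.j : ℕ) : ℝ) ^ 2) (msq / (L : ℝ) ^ 2) x y)
            + triple (ksH L a (msq / (L : ℝ) ^ 2) i x) (ksC L a (msq / (L : ℝ) ^ 2) i) (ksDH L a (msq / (L : ℝ) ^ 2) i ν y)) := by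
  rw [← flatten_unitVec (L ^ i.j) L (ksM L i) ν, ← flatten_add, fullProp_peel' L hL ha hm i x (y + _),
    fullProp_peel' L hL ha hm i x y, ← ksSliceD2_eq]
  push_cast
  ring

end Summit.QuantumFields.YangMills.BalabanUVNodes.N15KingModelRung.Curved
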